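import Literature.AlgebraicGeometry.Resolution.HenselizedFunctionFieldsBaseChangeLemmas
import HarnessLib

/-!
# The defect is invariant under finite unramified base change (Kuhlmann 2010, Prop. 2.18) — discharge of `Kuhlmann2010DefectUnramifiedBaseChange`

Topic: `Literature/AlgebraicGeometry/Resolution` (valued function fields). D-0014 keeps
`Literature/` sorry-free by stating cited results as named facts `def X : Prop`; this sibling of
`HenselizedFunctionFields.lean` PROVES its named fact `Kuhlmann2010DefectUnramifiedBaseChange`
(F.-V. Kuhlmann, *Elimination of ramification I: The generalized stability theorem*, Trans. AMS
362 (2010) 5697–5727 = arXiv:1003.5678, **Prop. 2.18**: "Let `(K,v)` be a henselian field and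
`N` an arbitrary algebraic extension of `K` within `K^r`. If `L|K` is a finite extension, then
`d(L|K,v) = d(L.N|N,v)`", vendored for `N|K` FINITE UNRAMIFIED inside the algebraically closed
ambient valued field `(Ω, V)`, with `d = [· : ·]/((v· : v·)[·v : ·v])` cleared of denominators):

* `isDefectlessExtension_sup_of_isUnramifiedOver` — **for `F` henselian, `N|F` finite unramified
  and `E ≥ F` finite, `(E.N|E, v)` is defectless**: `[E.N : E] = (v(E.N) : vE)·[(E.N)v : Ev]`.
* `Kuhlmann2010DefectUnramifiedBaseChange_holds` — the named fact, by the multiplicativity of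
  degrees, ramification indices and residue degrees along `F ≤ E ≤ E.N` and `F ≤ N ≤ E.N`
  (Lemma 2.13) from the defectlessness of `N|F` (`e = 1`, `f = [N : F]`) and of `E.N|E`.

The source proves Prop. 2.18 in [K6] (F.-V. Kuhlmann, Illinois J. Math. 54 (2010), Prop. 2.8)
for every algebraic `N ⊆ K^r`, through `L ∩ K^r`, purely wild extensions and
`vK^r = (1/n)ℤ`-divisible hulls; the finite unramified case needs none of this and is reached
by the classical argument below (ingredients in `HenselizedFunctionFieldsBaseChangeLemmas.lean`).

## Proof of `isDefectlessExtension_sup_of_isUnramifiedOver`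

Let `n = [N : F] = [Nv : Fv]`, `Nv|Fv` separable. Take a primitive element `ā` of `Nv|Fv`
(degree `n`) and a lift `a ∈ V ∩ N`. Since `F` is henselian, the `F`-conjugates of `a` lie in
`V`, so `μ = minpoly_F(a) = ∏ (X - aⱼ)` has coefficients in `V ∩ F` and reduces to a monic
`μ₀ ∈ Fv[X]` of degree `m = [F(a) : F] ≤ n` with `μ₀(ā) = 0`; hence `m = n`, `F(a) = N`,
`μ₀ = minpoly_{Fv}(ā)` is separable and the residues `āⱼ` are pairwise distinct. `E` is
henselian too (finite over `F`), `E.N = E(a)`, and `ν = minpoly_E(a)` divides `μ`: its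
`k = [E.N : E]` roots have distinct residues, each a root of `φ = minpoly_{Ev}(ā)` (conjugate by
an `E`-automorphism stabilising `V` and `𝔪_V` a lift of `φ`). Therefore
`k ≤ deg φ = [Ev(ā) : Ev] ≤ [(E.N)v : Ev] ≤ (v(E.N) : vE)·[(E.N)v : Ev] ≤ [E.N : E] = k`
(fundamental inequality, `relIndex_mul_relfinrank_le_relfinrank`), with equality throughout.

## Sources

* F.-V. Kuhlmann, Trans. AMS 362 (2010) = arXiv:1003.5678: §1 ((1), "`g = 1` if `(K,v)` is
  henselian"), §1.1, §1.2 ("unramified"), §2.3 (Lemma 2.13, Prop. 2.18); [K6] =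
  arXiv:1003.5639, Prop. 2.8 (the printed proof, not followed).
-/

noncomputable section

open IsLocalRing Polynomial
open scoped Pointwise IntermediateField

namespace Literature.AlgebraicGeometry.Resolution

universe u

variable {Ω : Type u} [Field Ω] (V : ValuationSubring Ω)

/-! ### Finite unramified extensions of a henselian field under finite base change -/

/-- **Finite unramified extensions of a henselian field stay defectless under finite base
change.** Inside the algebraically closed `(Ω, V)`: `F` henselian, `N|F` finite unramified,
`E ≥ F` finite; then `(E.N | E, v)` is defectless, `[E.N : E] = (v(E.N) : vE)·[(E.N)v : Ev]`.
Proof: a primitive element `ā` of the separable extension `Nv|Fv` lifts to `a ∈ V ∩ N`; all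
`F`-conjugates of `a` lie in `V` (`F` henselian), so `μ = minpoly_F(a)` reduces to a monic
`μ₀ ∈ Fv[X]` with `μ₀(ā) = 0`, forcing `[F(a) : F] = [N : F]`, `N = F(a)`, `μ₀ = minpoly(ā)`
separable; the `E`-conjugates of `a` are among the roots of `μ`, so their residues are
`[E(a) : E]` DISTINCT roots of `minpoly_{Ev}(ā)` (`E` is henselian too), whence
`[E.N : E] = [E(a) : E] ≤ [Ev(ā) : Ev] ≤ [(E.N)v : Ev] ≤ e·f ≤ [E.N : E]`.
[cite: Kuhlmann2010, Prop. 2.18 (with Section 1.1)] -/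
theorem isDefectlessExtension_sup_of_isUnramifiedOver [IsAlgClosed Ω] {F N E : Subfield Ω}
    (hF : IsHenselianField F (V.comap (algebraMap F Ω))) (hN : IsUnramifiedOver V F N)
    (hle : F ≤ E) (hpos : 0 < Subfield.relfinrank F E) :
    IsDefectlessExtension V E (E ⊔ N) := by
  classical
  -- Step 1: a primitive element `ā` of `Nv|Fv`, lifted to `a ∈ V ∩ N`
  obtain ⟨ā, hāNv, hāint, hāsep, hādeg⟩ := hN.exists_primitive_residue V
  obtain ⟨hFN, hNpos, -, -, -⟩ := hN
  obtain ⟨a, haN, haV, hares⟩ : ∃ a : Ω, a ∈ N ∧ ∃ haV : a ∈ V, residue V ⟨a, haV⟩ = ā := by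
    obtain ⟨c, hc, hca⟩ := (mem_residueSubfield_iff N V ā).mp hāNv
    exact ⟨c, c.2, hc, hca⟩
  subst hares
  have hE : IsHenselianField E (V.comap (algebraMap E Ω)) :=
    IsHenselianField.of_subfield_algebraic V hle
      (fun y hy => isAlgebraic_of_relfinrank_pos hle hpos hy) hF
  have haint : IsIntegral F a := (isAlgebraic_of_relfinrank_pos hFN hNpos haN).isIntegral
  -- Step 2: `[F(a) : F] ≤ [N : F] = deg minpoly(ā)`, so the residues of the `F`-conjugates of
  -- `a` are distinct and `F(a) = N`
  set Fa : Subfield Ω := (IntermediateField.adjoin F ({a} : Set Ω)).toSubfield with hFadef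
  have hF_Fa : F ≤ Fa := subfield_le_toSubfield _
  have hFa_N : Fa ≤ N := adjoin_simple_toSubfield_le hFN haN
  have hFa_deg : Subfield.relfinrank F Fa = (minpoly F a).natDegree :=
    relfinrank_adjoin_simple_eq_natDegree F haint
  have htower := Subfield.relfinrank_mul_relfinrank hF_Fa hFa_N
  have hFaN_pos : 0 < Subfield.relfinrank Fa N := by
    rcases Nat.eq_zero_or_pos (Subfield.relfinrank Fa N) with h0 | h0
    · rw [h0, mul_zero] at htower
      omega
    · exact h0
  have hdeg_le : (minpoly F a).natDegree ≤
      (minpoly (residueSubfield F V) (residue V ⟨a, haV⟩)).natDegree := by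
    rw [hādeg, ← hFa_deg, ← htower]
    exact Nat.le_mul_of_pos_right _ hFaN_pos
  obtain ⟨sμ, hsμ, hnodup, hdeg_eq⟩ := hF.exists_roots_lift_nodup V haV haint hāsep hdeg_le
  have hFaN : Fa = N := by
    refine le_antisymm hFa_N (Subfield.relfinrank_eq_one_iff.mp ?_)
    have h1 : Subfield.relfinrank F N * Subfield.relfinrank Fa N =
        Subfield.relfinrank F N * 1 := by
      rw [mul_one]
      conv_rhs => rw [← htower]
      rw [hFa_deg, hdeg_eq, hādeg]
    exact Nat.eq_of_mul_eq_mul_left hNpos h1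
  -- Step 3: `ν = minpoly_E(a)` divides `μ`: its roots lie in `V` with distinct residues, so
  -- `deg ν ≤ deg minpoly_{Ev}(ā)`
  letI : Algebra F E := (Subfield.inclusion hle).toAlgebra
  haveI : IsScalarTower F E Ω := IsScalarTower.of_algebraMap_eq fun _ => rfl
  have haintE : IsIntegral E a := haint.tower_top
  have hμ0 : (minpoly F a).map (algebraMap F Ω) ≠ 0 := ((minpoly.monic haint).map _).ne_zero
  have hνdvd : (minpoly E a).map (algebraMap E Ω) ∣ (minpoly F a).map (algebraMap F Ω) := by
    rw [IsScalarTower.algebraMap_eq F E Ω, ← Polynomial.map_map]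
    exact Polynomial.map_dvd _ (minpoly.dvd_map_of_isScalarTower F E a)
  have hrootsle : ((minpoly E a).map (algebraMap E Ω)).roots ≤
      ((minpoly F a).map (algebraMap F Ω)).roots := roots.le_of_dvd hμ0 hνdvd
  have hrootsν : ∀ r ∈ ((minpoly E a).map (algebraMap E Ω)).roots, r ∈ V := by
    intro r hr
    have h : r ∈ sμ.map Subtype.val := by rw [hsμ]; exact Multiset.mem_of_le hrootsle hr
    obtain ⟨r', -, rfl⟩ := Multiset.mem_map.mp h
    exact r'.2
  obtain ⟨sν, -, hsν, -, -, -⟩ :=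
    exists_monic_map_eq_prod_residue V E (minpoly.monic haintE) hrootsν
  have hRν_nodup : (sν.map (residue V)).Nodup := by
    have hle' : sν ≤ sμ := by
      rw [← Multiset.map_le_map_iff Subtype.val_injective, hsν, hsμ]
      exact hrootsle
    exact Multiset.nodup_of_le (Multiset.map_le_map hle') hnodup
  -- Step 4: `E.N = E(a)`, so `[E.N : E] = deg ν`
  set Ea : Subfield Ω := (IntermediateField.adjoin E ({a} : Set Ω)).toSubfield with hEadef
  have hE_Ea : E ≤ Ea := subfield_le_toSubfield _
  have ha_Ea : a ∈ Ea := IntermediateField.mem_adjoin_simple_self E a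
  have hEa_deg : Subfield.relfinrank E Ea = (minpoly E a).natDegree :=
    relfinrank_adjoin_simple_eq_natDegree E haintE
  have hsup : E ⊔ N = Ea := by
    refine le_antisymm (sup_le hE_Ea ?_)
      (adjoin_simple_toSubfield_le le_sup_left (le_sup_right (a := E) haN))
    rw [← hFaN, hFadef, hEadef, IntermediateField.adjoin_toSubfield,
      IntermediateField.adjoin_toSubfield, range_algebraMap_subfield, range_algebraMap_subfield]
    exact Subfield.closure_mono (Set.union_subset_union_left _ (SetLike.coe_subset_coe.mpr hle))
  rw [hsup]
  have hEa_pos : 0 < Subfield.relfinrank E Ea := by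
    rw [hEa_deg]
    exact minpoly.natDegree_pos haintE
  obtain ⟨he, hf, hef⟩ := relIndex_mul_relfinrank_le_relfinrank V hE_Ea hEa_pos
  -- Step 5: `deg ν ≤ deg minpoly_{Ev}(ā) = [Ev(ā) : Ev] ≤ [Ea v : Ev]`
  have hāEav : residue V ⟨a, haV⟩ ∈ residueSubfield Ea V :=
    residue_mem_residueSubfield Ea V ⟨a, ha_Ea⟩ haV
  have hEv_le : residueSubfield E V ≤ residueSubfield Ea V := residueSubfield_subfield_mono hE_Ea
  have hāintE : IsIntegral (residueSubfield E V) (residue V ⟨a, haV⟩) :=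
    (isAlgebraic_of_relfinrank_pos hEv_le hf hāEav).isIntegral
  have hk_le := hE.natDegree_minpoly_le_of_nodup V haV haintE hāintE hsν hRν_nodup
  set Evā : Subfield (ResidueField V) := (IntermediateField.adjoin (residueSubfield E V)
    ({residue V ⟨a, haV⟩} : Set (ResidueField V))).toSubfield with hEvādef
  have h1 : residueSubfield E V ≤ Evā := subfield_le_toSubfield _
  have h2 : Evā ≤ residueSubfield Ea V := adjoin_simple_toSubfield_le hEv_le hāEav
  have hEvā_deg : Subfield.relfinrank (residueSubfield E V) Evā =
      (minpoly (residueSubfield E V) (residue V ⟨a, haV⟩)).natDegree :=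
    relfinrank_adjoin_simple_eq_natDegree _ hāintE
  have htower2 := Subfield.relfinrank_mul_relfinrank h1 h2
  have hf_ge : (minpoly (residueSubfield E V) (residue V ⟨a, haV⟩)).natDegree ≤
      (residueSubfield E V).relfinrank (residueSubfield Ea V) := by
    rw [← hEvā_deg, ← htower2]
    refine Nat.le_mul_of_pos_right _ ?_
    rcases Nat.eq_zero_or_pos (Subfield.relfinrank Evā (residueSubfield Ea V)) with h0 | h0
    · rw [h0, mul_zero] at htower2
      omega
    · exact h0
  -- the squeeze `[Ea : E] = deg ν ≤ deg minpoly_{Ev}(ā) ≤ f ≤ e·f ≤ [Ea : E]`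
  refine ⟨hE_Ea, hEa_pos, le_antisymm ?_ hef⟩
  calc Subfield.relfinrank E Ea = (minpoly E a).natDegree := hEa_deg
    _ ≤ (residueSubfield E V).relfinrank (residueSubfield Ea V) := hk_le.trans hf_ge
    _ ≤ _ := Nat.le_mul_of_pos_left _ he

/-! ### The discharge -/

/-- **Kuhlmann 2010, Prop. 2.18, as vendored (`Kuhlmann2010DefectUnramifiedBaseChange`):
`d(E|F, v) = d(E.N|N, v)` for `F` henselian, `N|F` finite unramified and `E|F` finite** —
PROVED: `[E:F][E.N:E] = [E.N:F] = [N:F][E.N:N]`, `e` and `f` are multiplicative along both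
towers, `N|F` is defectless (`e = 1`, `f = [N:F]`) and so is `E.N|E`
(`isDefectlessExtension_sup_of_isUnramifiedOver`); cancelling `[E.N:E]·[N:F] > 0` gives
`[E:F]·e(E.N|N)f(E.N|N) = [E.N:N]·e(E|F)f(E|F)`. The source states Prop. 2.18 for an arbitrary
algebraic `N ⊆ K^r` and proves it in [K6] (= F.-V. Kuhlmann, Illinois J. Math. 54 (2010),
Prop. 2.8) through the absolute ramification field; the finite unramified case vendored in
`HenselizedFunctionFields.lean` is reached here by the elementary argument above.
[cite: Kuhlmann2010, Prop. 2.18] -/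
theorem Kuhlmann2010DefectUnramifiedBaseChange_holds :
    Kuhlmann2010DefectUnramifiedBaseChange.{u} := by
  intro Ω _ _ V F N E hF hN hle hpos
  obtain ⟨hET, hTpos, hTeq⟩ := isDefectlessExtension_sup_of_isUnramifiedOver V hF hN hle hpos
  obtain ⟨hFN, hNpos, hNdeg, -, hvN⟩ := hN
  have hNT : N ≤ E ⊔ N := le_sup_right
  -- `[E:F][E.N:E] = [N:F][E.N:N]`
  have hn := (Subfield.relfinrank_mul_relfinrank hle hET).trans
    (Subfield.relfinrank_mul_relfinrank hFN hNT).symm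
  -- `e`, `f` multiplicative along `F ≤ E ≤ E.N` and `F ≤ N ≤ E.N`
  have he := (Subgroup.relIndex_mul_relIndex _ _ _ (valueSubgroup_subfield_mono (V := V) hle)
    (valueSubgroup_subfield_mono hET)).trans (Subgroup.relIndex_mul_relIndex _ _ _
      (valueSubgroup_subfield_mono (V := V) hFN) (valueSubgroup_subfield_mono hNT)).symm
  have hf := (Subfield.relfinrank_mul_relfinrank (residueSubfield_subfield_mono (V := V) hle)
    (residueSubfield_subfield_mono hET)).trans (Subfield.relfinrank_mul_relfinrank
      (residueSubfield_subfield_mono (V := V) hFN) (residueSubfield_subfield_mono hNT)).symm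
  -- `N|F`: `e = 1`, `f = [N : F]`
  have he₃ : (valueSubgroup F V).relIndex (valueSubgroup N V) = 1 := by
    rw [hvN, Subgroup.relIndex_self]
  rw [he₃, one_mul] at he
  rw [← hNdeg] at hf
  -- abbreviations
  set a := Subfield.relfinrank F E
  set b := Subfield.relfinrank E (E ⊔ N)
  set c := Subfield.relfinrank F N
  set d := Subfield.relfinrank N (E ⊔ N)
  set e₁ := (valueSubgroup F V).relIndex (valueSubgroup E V)
  set e₂ := (valueSubgroup E V).relIndex (valueSubgroup (↥(E ⊔ N)) V)
  set e₄ := (valueSubgroup N V).relIndex (valueSubgroup (↥(E ⊔ N)) V)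
  set f₁ := (residueSubfield F V).relfinrank (residueSubfield E V)
  set f₂ := (residueSubfield E V).relfinrank (residueSubfield (↥(E ⊔ N)) V)
  set f₄ := (residueSubfield N V).relfinrank (residueSubfield (↥(E ⊔ N)) V)
  have hkey : e₁ * f₁ * b = c * (e₄ * f₄) :=
    calc e₁ * f₁ * b = (e₁ * e₂) * (f₁ * f₂) := by rw [hTeq]; ring
      _ = e₄ * (c * f₄) := by rw [he, hf]
      _ = c * (e₄ * f₄) := by ring
  refine Nat.eq_of_mul_eq_mul_left hNpos ?_
  calc c * (a * (e₄ * f₄)) = a * (c * (e₄ * f₄)) := by ring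
    _ = a * (e₁ * f₁ * b) := by rw [hkey]
    _ = (a * b) * (e₁ * f₁) := by ring
    _ = (c * d) * (e₁ * f₁) := by rw [hn]
    _ = c * (d * (e₁ * f₁)) := by ring

end Literature.AlgebraicGeometry.Resolution
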